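import Summits.Parity.BatemanHorn.Theorems.NormalFamilyBound.Negative.RealAxis

/-!
# Crux `NormalFamilyBound` (stmt-Parity-9769), line `Sketch` (card `renewal-phase-bootstrap`): the skeleton

Route `SelbergDelangeRigidity`, crux decl `Summit.Parity.BatemanHorn.Theses.SelbergDelangeRigidity.NormalFamilyBound`:
for every Bateman–Horn system `f` the family `H_x(z) = x⁻¹ (log x)^{k(1−z)} S_x(z)`, `S_x(z) = Σ_{n ≤ x} z^{Ω_f(n)}`,
is locally bounded on a thin rectangle `V_η = {−η < Re z < 7/4, |Im z| < η}`.

The line (ideator 2, `Cruxes/NormalFamilyBound/Ideator2Sketch.lean`, renewal-phase-bootstrap half; lead's reshaping):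
bound `log ‖S_x(re^{iθ})‖` along arcs of fixed modulus through its exact angular derivative `−Im E_z[Ω_f]`,
`E_z := z S_x'(z)/S_x(z)`, by a one-sided Grönwall / barrier argument (`stub_arcBarrier`), starting
* on `Re z > 0` from the POSITIVE real point `r = |z|` (`stub_realAxisOrder`: Nair–Tenenbaum order of magnitude,
  positive weights) with the phase-velocity LOWER bound `stub_phaseVelocityLB` (the content on R+) — `stub_bootstrapTransfer`;
* on the near-zero box `−η < Re z ≤ 0` from the NEGATIVE real point `−t`, `t = |z|` (`stub_realSegmentParity`: the
  crux at the negative real points, the parity atom) with the ghost-insensitive UPPER bound `stub_phaseVelocityUB` —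
  `stub_negativeAnchorTransfer`.
`NormalFamilyBound_of_stubs` composes (sorry-free: shrinking `η`, the two boxes, the finitely many `x ≤ 2`, the ball form);
`NormalFamilyBound_of` concludes the route decl BY NAME. Regions are chosen so that every arc used stays where the
phase-velocity hypotheses apply (moduli `≤ 15/8 < 2`; `|θ| < π/2` on R+; `π/2 ≤ |φ| ≤ π`, `t < 2η` on the left box).

Vocabulary: `V`, `Ωf`, `H`, `locallyBoundedSystems` of `Theorems/NormalFamilyBound/Negative/RealAxis.lean` (landed).
-/

namespace Summit.Parity.BatemanHorn.Cruxes.NormalFamilyBound.RenewalPhaseBootstrap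

open Literature.NumberTheory.Sieve Polynomial Finset Filter
open Summit.Parity.BatemanHorn.Theses.SelbergDelangeRigidity
open Summit.Parity.BatemanHorn.Theorems.NormalFamilyBound.Negative

noncomputable section

/-! ## The stubs -/

/-- STUB (known in print; Nair–Tenenbaum 1998 Thm 1 / Henriot 2012 Thm 3 with the standard small-prime reduction
for `1 < r ≤ 15/8`): the positive-weight real-axis ORDER OF MAGNITUDE along a Bateman–Horn system, uniform in the
tilt `0 < r ≤ 15/8`: `S_x(r) = Σ_{n ≤ x} r^{Ω_f(n)} ≤ C x (log x)^{k(r−1)}` for `x ≥ 3`. -/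
theorem stub_realAxisOrder :
    ∀ (k : ℕ) (f : Fin k → ℤ[X]), IsBatemanHornSystem f → ∃ C : ℝ, ∀ x : ℕ, 3 ≤ x →
      ∀ r : ℝ, 0 < r → r ≤ 15 / 8 →
        ∑ n ∈ Finset.range (x + 1), r ^ Ωf f n ≤ C * x * Real.log x ^ ((k : ℝ) * (r - 1)) := by
  sorry

/-- STUB (the content on R+, card's `C⁺`; lead): PHASE-VELOCITY LOWER BOUND. For some `η > 0` and constants
`C`, `K ≥ 0`: for `x ≥ 3`, along every arc point `z = re^{iθ}` with `0 < r ≤ 15/8`, `|θ| < π/2`, `|r sin θ| < η`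
at which `‖S_x(z)‖` is still within `e^{−K}(log x)^{−kr(1−cos θ)}` of `S_x(r)`, the imaginary part of the tilted
mean `E_z[Ω_f] = z S_x'(z)/S_x(z)` in the direction of travel is at least its model value `k r |sin θ| log log x`
minus `C`. -/
theorem stub_phaseVelocityLB :
    ∀ (k : ℕ) (f : Fin k → ℤ[X]), IsBatemanHornSystem f → ∃ η : ℝ, 0 < η ∧ ∃ C K : ℝ, 0 ≤ K ∧
      ∀ x : ℕ, 3 ≤ x → ∀ r θ : ℝ, 0 < r → r ≤ 15 / 8 → |θ| < Real.pi / 2 → |r * Real.sin θ| < η →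
        Real.exp (-K) * Real.log x ^ (-((k : ℝ) * r * (1 - Real.cos θ))) *
            (∑ n ∈ Finset.range (x + 1), r ^ Ωf f n) ≤
          ‖∑ n ∈ Finset.range (x + 1), ((r : ℂ) * Complex.exp ((θ : ℂ) * Complex.I)) ^ Ωf f n‖ →
        (k : ℝ) * r * |Real.sin θ| * Real.log (Real.log x) - C ≤
          Real.sign θ *
            ((∑ n ∈ Finset.range (x + 1), (Ωf f n : ℂ) * ((r : ℂ) * Complex.exp ((θ : ℂ) * Complex.I)) ^ Ωf f n) /
              (∑ n ∈ Finset.range (x + 1), ((r : ℂ) * Complex.exp ((θ : ℂ) * Complex.I)) ^ Ωf f n)).im := by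
  sorry

/-- STUB (provable now; phase derivative + one-sided Grönwall): the ARC BARRIER lemma. For a complex polynomial `P`,
a radius `r > 0` and a differentiable barrier `b` on `[φ₀, φ₁]`: if `‖P(re^{iφ₀})‖ ≤ e^{b(φ₀)}` and, at every interior
angle where `‖P(re^{iφ})‖` EXCEEDS `e^{b(φ)}`, the angular derivative `−Im(z P'(z)/P(z))` of `log ‖P(re^{iφ})‖` is at
most `b'(φ)`, then `‖P(re^{iφ})‖ ≤ e^{b(φ)}` on the whole of `[φ₀, φ₁]` (sup of the last crossing + mean value theorem;
zeros of `P` never enter since the hypothesis is only used strictly above the positive barrier). -/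
theorem stub_arcBarrier :
    ∀ (P : Polynomial ℂ) (r φ₀ φ₁ : ℝ) (b b' : ℝ → ℝ), 0 < r → φ₀ ≤ φ₁ →
      (∀ φ ∈ Set.Icc φ₀ φ₁, HasDerivAt b (b' φ) φ) →
      ‖P.eval ((r : ℂ) * Complex.exp ((φ₀ : ℂ) * Complex.I))‖ ≤ Real.exp (b φ₀) →
      (∀ φ ∈ Set.Ioo φ₀ φ₁,
        Real.exp (b φ) < ‖P.eval ((r : ℂ) * Complex.exp ((φ : ℂ) * Complex.I))‖ →
          -(((r : ℂ) * Complex.exp ((φ : ℂ) * Complex.I) *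
              (Polynomial.derivative P).eval ((r : ℂ) * Complex.exp ((φ : ℂ) * Complex.I)) /
              P.eval ((r : ℂ) * Complex.exp ((φ : ℂ) * Complex.I))).im) ≤ b' φ) →
      ∀ φ ∈ Set.Icc φ₀ φ₁, ‖P.eval ((r : ℂ) * Complex.exp ((φ : ℂ) * Complex.I))‖ ≤ Real.exp (b φ) := by
  sorry

/-- STUB (provable now): the BOOTSTRAP TRANSFER on R+. The arc barrier lemma, a phase-velocity lower bound on the
region `{0 < r ≤ 15/8, |θ| < π/2, |r sin θ| < η}` and the real-axis order of magnitude up to `r ≤ 15/8` give ONE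
bound `‖H_x(z)‖ ≤ M` for all `x ≥ 3` on `{0 < Re z < 7/4, |Im z| < η}` (arcs `|z| = r` from the real base point
`r = |z| ≤ √(49/16 + η²) ≤ 15/8`; barrier `b(φ) = log S_x(r) + C|φ| − k r (1 − cos φ) log log x`; the conclusion
`‖S_x(z)‖ ≤ e^{Cπ/2} S_x(|z|) (log x)^{−k(|z|−Re z)} ≤ e^{Cπ/2} C_r x (log x)^{k(Re z−1)}` is `‖H_x(z)‖ ≤ e^{Cπ/2} C_r`). -/
theorem stub_bootstrapTransfer :
    (∀ (P : Polynomial ℂ) (r φ₀ φ₁ : ℝ) (b b' : ℝ → ℝ), 0 < r → φ₀ ≤ φ₁ →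
      (∀ φ ∈ Set.Icc φ₀ φ₁, HasDerivAt b (b' φ) φ) →
      ‖P.eval ((r : ℂ) * Complex.exp ((φ₀ : ℂ) * Complex.I))‖ ≤ Real.exp (b φ₀) →
      (∀ φ ∈ Set.Ioo φ₀ φ₁,
        Real.exp (b φ) < ‖P.eval ((r : ℂ) * Complex.exp ((φ : ℂ) * Complex.I))‖ →
          -(((r : ℂ) * Complex.exp ((φ : ℂ) * Complex.I) *
              (Polynomial.derivative P).eval ((r : ℂ) * Complex.exp ((φ : ℂ) * Complex.I)) /
              P.eval ((r : ℂ) * Complex.exp ((φ : ℂ) * Complex.I))).im) ≤ b' φ) →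
      ∀ φ ∈ Set.Icc φ₀ φ₁, ‖P.eval ((r : ℂ) * Complex.exp ((φ : ℂ) * Complex.I))‖ ≤ Real.exp (b φ)) →
    ∀ (k : ℕ) (f : Fin k → ℤ[X]) (η C K Cr : ℝ), 0 < η → η ≤ 1 / 4 → 0 ≤ K →
      (∀ x : ℕ, 3 ≤ x → ∀ r θ : ℝ, 0 < r → r ≤ 15 / 8 → |θ| < Real.pi / 2 → |r * Real.sin θ| < η →
        Real.exp (-K) * Real.log x ^ (-((k : ℝ) * r * (1 - Real.cos θ))) *
            (∑ n ∈ Finset.range (x + 1), r ^ Ωf f n) ≤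
          ‖∑ n ∈ Finset.range (x + 1), ((r : ℂ) * Complex.exp ((θ : ℂ) * Complex.I)) ^ Ωf f n‖ →
        (k : ℝ) * r * |Real.sin θ| * Real.log (Real.log x) - C ≤
          Real.sign θ *
            ((∑ n ∈ Finset.range (x + 1), (Ωf f n : ℂ) * ((r : ℂ) * Complex.exp ((θ : ℂ) * Complex.I)) ^ Ωf f n) /
              (∑ n ∈ Finset.range (x + 1), ((r : ℂ) * Complex.exp ((θ : ℂ) * Complex.I)) ^ Ωf f n)).im) →
      (∀ x : ℕ, 3 ≤ x → ∀ r : ℝ, 0 < r → r ≤ 15 / 8 →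
        ∑ n ∈ Finset.range (x + 1), r ^ Ωf f n ≤ Cr * x * Real.log x ^ ((k : ℝ) * (r - 1))) →
      ∃ M : ℝ, ∀ x : ℕ, 3 ≤ x → ∀ z : ℂ, 0 < z.re → z.re < 7 / 4 → |z.im| < η → ‖H k f x z‖ ≤ M := by
  sorry

/-- STUB (the parity atom; = the crux restricted to the negative real points): REAL-SEGMENT PARITY. For some
`η₀ > 0` and `C₀`, the real alternating almost-prime sums `S_x(−t) = Σ_j π_j(x) (−t)^j` have the Landau–Selberg–Delange
order `C₀ x (log x)^{−k(1+t)}` for `0 < t < η₀`, `x ≥ 3`. -/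
theorem stub_realSegmentParity :
    ∀ (k : ℕ) (f : Fin k → ℤ[X]), IsBatemanHornSystem f → ∃ η₀ : ℝ, 0 < η₀ ∧ ∃ C₀ : ℝ,
      ∀ x : ℕ, 3 ≤ x → ∀ t : ℝ, 0 < t → t < η₀ →
        ‖∑ n ∈ Finset.range (x + 1), (-(t : ℂ)) ^ Ωf f n‖ ≤ C₀ * x * Real.log x ^ (-((k : ℝ) * (1 + t))) := by
  sorry

/-- STUB (ghost-insensitive companion on the left box): PHASE-VELOCITY UPPER BOUND. For some `η > 0` and constants
`C`, `K ≥ 0`: for `x ≥ 3`, at every point `z = te^{iφ}` with `0 < t < 2η`, `π/2 ≤ |φ| ≤ π`, `|t sin φ| < η` at which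
`‖S_x(z)‖ ≥ e^{−K} x (log x)^{k(t cos φ − 1)}` (within `e^{−K}` of the TARGET), the tilted mean grows at most at the
model rate away from the negative axis: `sign(φ) · Im E_z[Ω_f] ≤ k t |sin φ| log log x + C`. -/
theorem stub_phaseVelocityUB :
    ∀ (k : ℕ) (f : Fin k → ℤ[X]), IsBatemanHornSystem f → ∃ η : ℝ, 0 < η ∧ ∃ C K : ℝ, 0 ≤ K ∧
      ∀ x : ℕ, 3 ≤ x → ∀ t φ : ℝ, 0 < t → t < 2 * η → Real.pi / 2 ≤ |φ| → |φ| ≤ Real.pi →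
        |t * Real.sin φ| < η →
        Real.exp (-K) * x * Real.log x ^ ((k : ℝ) * (t * Real.cos φ - 1)) ≤
          ‖∑ n ∈ Finset.range (x + 1), ((t : ℂ) * Complex.exp ((φ : ℂ) * Complex.I)) ^ Ωf f n‖ →
        Real.sign φ *
            ((∑ n ∈ Finset.range (x + 1), (Ωf f n : ℂ) * ((t : ℂ) * Complex.exp ((φ : ℂ) * Complex.I)) ^ Ωf f n) /
              (∑ n ∈ Finset.range (x + 1), ((t : ℂ) * Complex.exp ((φ : ℂ) * Complex.I)) ^ Ωf f n)).im ≤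
          (k : ℝ) * t * |Real.sin φ| * Real.log (Real.log x) + C := by
  sorry

/-- STUB (provable now): the NEGATIVE-ANCHOR TRANSFER on the near-zero box. The arc barrier lemma, real-segment parity
for `t < 2η` and the phase-velocity upper bound give ONE bound `‖H_x(z)‖ ≤ M` for all `x ≥ 3` on the left box
`{−η < Re z ≤ 0, |Im z| < η}` (every `z ≠ 0` there is `te^{iφ}` with `t < η√2 < 2η`, `π/2 ≤ |φ| ≤ π`; by the conjugation
symmetry `S_x(z̄) = conj S_x(z)` one may take `Im z ≤ 0` and run the arc `ψ ↦ te^{iψ}` UP from `ψ = π` (the point `−t`, where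
parity gives the start value) with barrier `b(ψ) = log(max(C₀,1) x) + k(t cos ψ − 1) log log x + C(ψ − π)`; `z = 0` follows
by continuity of the entire `H_x`). -/
theorem stub_negativeAnchorTransfer :
    (∀ (P : Polynomial ℂ) (r φ₀ φ₁ : ℝ) (b b' : ℝ → ℝ), 0 < r → φ₀ ≤ φ₁ →
      (∀ φ ∈ Set.Icc φ₀ φ₁, HasDerivAt b (b' φ) φ) →
      ‖P.eval ((r : ℂ) * Complex.exp ((φ₀ : ℂ) * Complex.I))‖ ≤ Real.exp (b φ₀) →
      (∀ φ ∈ Set.Ioo φ₀ φ₁,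
        Real.exp (b φ) < ‖P.eval ((r : ℂ) * Complex.exp ((φ : ℂ) * Complex.I))‖ →
          -(((r : ℂ) * Complex.exp ((φ : ℂ) * Complex.I) *
              (Polynomial.derivative P).eval ((r : ℂ) * Complex.exp ((φ : ℂ) * Complex.I)) /
              P.eval ((r : ℂ) * Complex.exp ((φ : ℂ) * Complex.I))).im) ≤ b' φ) →
      ∀ φ ∈ Set.Icc φ₀ φ₁, ‖P.eval ((r : ℂ) * Complex.exp ((φ : ℂ) * Complex.I))‖ ≤ Real.exp (b φ)) →
    ∀ (k : ℕ) (f : Fin k → ℤ[X]) (η C₀ C K : ℝ), 0 < η → η ≤ 1 / 4 → 0 ≤ K →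
      (∀ x : ℕ, 3 ≤ x → ∀ t : ℝ, 0 < t → t < 2 * η →
        ‖∑ n ∈ Finset.range (x + 1), (-(t : ℂ)) ^ Ωf f n‖ ≤ C₀ * x * Real.log x ^ (-((k : ℝ) * (1 + t)))) →
      (∀ x : ℕ, 3 ≤ x → ∀ t φ : ℝ, 0 < t → t < 2 * η → Real.pi / 2 ≤ |φ| → |φ| ≤ Real.pi →
        |t * Real.sin φ| < η →
        Real.exp (-K) * x * Real.log x ^ ((k : ℝ) * (t * Real.cos φ - 1)) ≤
          ‖∑ n ∈ Finset.range (x + 1), ((t : ℂ) * Complex.exp ((φ : ℂ) * Complex.I)) ^ Ωf f n‖ →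
        Real.sign φ *
            ((∑ n ∈ Finset.range (x + 1), (Ωf f n : ℂ) * ((t : ℂ) * Complex.exp ((φ : ℂ) * Complex.I)) ^ Ωf f n) /
              (∑ n ∈ Finset.range (x + 1), ((t : ℂ) * Complex.exp ((φ : ℂ) * Complex.I)) ^ Ωf f n)).im ≤
          (k : ℝ) * t * |Real.sin φ| * Real.log (Real.log x) + C) →
      ∃ M : ℝ, ∀ x : ℕ, 3 ≤ x → ∀ z : ℂ, -η < z.re → z.re ≤ 0 → |z.im| < η → ‖H k f x z‖ ≤ M := by
  sorry

/-! ## The composition (sorry-free) -/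

/-- `|log log x| ≤ 1` for the finitely many `x ≤ 2` (`log log 0 = log log 1 = 0`, `log log 2 ∈ (−1, 0)`). -/
theorem abs_loglog_le_one_of_le_two {x : ℕ} (hx : x ≤ 2) : |Real.log (Real.log (x : ℝ))| ≤ 1 := by
  interval_cases x
  · simp
  · simp
  · rw [show ((2 : ℕ) : ℝ) = 2 by norm_num]
    have hl0 : (1 : ℝ) / 2 < Real.log 2 := by have := Real.log_two_gt_d9; linarith
    have hl1 : Real.log 2 ≤ 1 := by
      have := Real.log_le_sub_one_of_pos (by norm_num : (0 : ℝ) < 2); linarith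
    have hup : Real.log (Real.log 2) ≤ 0 := Real.log_nonpos (by linarith) hl1
    have hdown : -1 ≤ Real.log (Real.log 2) := by
      have h := Real.log_le_log (by norm_num : (0:ℝ) < 1 / 2) hl0.le
      have e : Real.log (1 / 2 : ℝ) = -Real.log 2 := by rw [one_div, Real.log_inv]
      rw [e] at h
      linarith
    exact abs_le.mpr ⟨hdown, by linarith⟩

/-- The finitely many `x ≤ 2`: each `H_x` is bounded on `{‖z‖ ≤ 2}` by an explicit constant (`x⁻¹ ≤ 1`,
`‖exp(k(1−z) log log x)‖ ≤ e^{3k}`, at most three terms of norm `≤ 2^{Ω_f(n)}`). -/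
theorem norm_H_le_of_le_two (k : ℕ) (f : Fin k → ℤ[X]) {x : ℕ} (hx : x ≤ 2) {z : ℂ} (hz : ‖z‖ ≤ 2) :
    ‖H k f x z‖ ≤ Real.exp (3 * k) * ∑ n ∈ Finset.range 3, (2 : ℝ) ^ Ωf f n := by
  have hsum_nonneg : 0 ≤ ∑ n ∈ Finset.range 3, (2 : ℝ) ^ Ωf f n :=
    Finset.sum_nonneg fun n _ => by positivity
  -- x⁻¹ ≤ 1
  have hinv : ‖((x : ℂ))⁻¹‖ ≤ 1 := by
    rw [norm_inv, Complex.norm_natCast]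
    rcases Nat.eq_zero_or_pos x with rfl | hx0
    · simp
    · have : (1 : ℝ) ≤ x := by exact_mod_cast hx0
      exact inv_le_one_of_one_le₀ this
  -- the normaliser
  have hN : ‖Complex.exp ((k : ℂ) * (1 - z) * (Real.log (Real.log (x : ℝ)) : ℂ))‖ ≤ Real.exp (3 * k) := by
    rw [Complex.norm_exp]
    apply Real.exp_le_exp.mpr
    have h1 : ((k : ℂ) * (1 - z) * (Real.log (Real.log (x : ℝ)) : ℂ)).re ≤
        ‖(k : ℂ) * (1 - z) * (Real.log (Real.log (x : ℝ)) : ℂ)‖ := Complex.re_le_norm _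
    refine h1.trans ?_
    rw [norm_mul, norm_mul, Complex.norm_natCast, Complex.norm_real, Real.norm_eq_abs]
    have h1z : ‖(1 : ℂ) - z‖ ≤ 3 := by
      calc ‖(1 : ℂ) - z‖ ≤ ‖(1 : ℂ)‖ + ‖z‖ := norm_sub_le _ _
        _ ≤ 1 + 2 := by rw [norm_one]; linarith
        _ = 3 := by norm_num
    have hL := abs_loglog_le_one_of_le_two hx
    have hk : (0 : ℝ) ≤ k := Nat.cast_nonneg k
    calc (k : ℝ) * ‖(1 : ℂ) - z‖ * |Real.log (Real.log (x : ℝ))| ≤ (k : ℝ) * 3 * 1 := by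
          gcongr
      _ = 3 * k := by ring
  -- the sum
  have hS : ‖∑ n ∈ Finset.range (x + 1),
      z ^ (∑ i, ArithmeticFunction.cardFactors (((f i).eval (n : ℤ)).toNat))‖ ≤
      ∑ n ∈ Finset.range 3, (2 : ℝ) ^ Ωf f n := by
    calc ‖∑ n ∈ Finset.range (x + 1), z ^ (∑ i, ArithmeticFunction.cardFactors (((f i).eval (n : ℤ)).toNat))‖
        ≤ ∑ n ∈ Finset.range (x + 1), ‖z ^ (∑ i, ArithmeticFunction.cardFactors (((f i).eval (n : ℤ)).toNat))‖ :=
          norm_sum_le _ _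
      _ = ∑ n ∈ Finset.range (x + 1), ‖z‖ ^ Ωf f n := by
          refine Finset.sum_congr rfl fun n _ => ?_
          rw [norm_pow]; rfl
      _ ≤ ∑ n ∈ Finset.range (x + 1), (2 : ℝ) ^ Ωf f n :=
          Finset.sum_le_sum fun n _ => pow_le_pow_left₀ (norm_nonneg _) hz _
      _ ≤ ∑ n ∈ Finset.range 3, (2 : ℝ) ^ Ωf f n := by
          apply Finset.sum_le_sum_of_subset_of_nonneg
          · exact Finset.range_mono (by omega)
          · intro n _ _; positivity
  calc ‖H k f x z‖ = ‖((x : ℂ))⁻¹‖ * ‖Complex.exp ((k : ℂ) * (1 - z) * (Real.log (Real.log (x : ℝ)) : ℂ))‖ *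
        ‖∑ n ∈ Finset.range (x + 1), z ^ (∑ i, ArithmeticFunction.cardFactors (((f i).eval (n : ℤ)).toNat))‖ := by
        rw [H, norm_mul, norm_mul]
    _ ≤ 1 * Real.exp (3 * k) * ∑ n ∈ Finset.range 3, (2 : ℝ) ^ Ωf f n := by
        gcongr
    _ = Real.exp (3 * k) * ∑ n ∈ Finset.range 3, (2 : ℝ) ^ Ωf f n := by ring

/-- Points of the thin rectangle have modulus `< 15/8` (and `≤ 2`). -/
theorem norm_lt_of_mem_V {η : ℝ} (hη : η ≤ 1 / 4) {z : ℂ} (hz : z ∈ V (7 / 4) η) : ‖z‖ < 15 / 8 := by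
  obtain ⟨h1, h2, h3⟩ := hz
  have him := abs_lt.mp h3
  have hsq : ‖z‖ ^ 2 < (15 / 8) ^ 2 := by
    rw [Complex.sq_norm, Complex.normSq_apply]
    nlinarith [him.1, him.2]
  exact lt_of_pow_lt_pow_left₀ 2 (by norm_num) hsq

/-- GLOBAL ⇒ LOCAL: a uniform bound `‖H_x(z)‖ ≤ M` for all `x` and all `z ∈ V_{R,η}`, `η > 0`, puts `f` in
`locallyBoundedSystems R k` (same statement as the disprover's `Negative.Shape.mem_locallyBoundedSystems_of_uniform`,
re-proved here to keep the skeleton's imports to the built `Negative.RealAxis`). -/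
theorem mem_locallyBoundedSystems_of_uniform_bound {R : ℝ} {k : ℕ} {f : Fin k → ℤ[X]} {η M : ℝ} (hη : 0 < η)
    (h : ∀ x : ℕ, ∀ z ∈ V R η, ‖H k f x z‖ ≤ M) : f ∈ locallyBoundedSystems R k := by
  refine ⟨min η (1 / 4), lt_min hη (by norm_num), min_le_right _ _, fun a _ => ⟨M, 1, one_pos, fun x z hz => ?_⟩⟩
  obtain ⟨h1, h2, h3⟩ := hz.2
  have hle : min η (1 / 4) ≤ η := min_le_left _ _
  exact h x z ⟨by linarith, h2, by linarith⟩

/-- PACKAGING: one bound for `x ≥ 3` on `V_{7/4,η}` gives membership in `locallyBoundedSystems (7/4) k`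
(the `x ≤ 2` are bounded by `norm_H_le_of_le_two`; then `mem_locallyBoundedSystems_of_uniform_bound`). -/
theorem mem_locallyBoundedSystems_of_uniform_three_le {k : ℕ} {f : Fin k → ℤ[X]} {η M : ℝ} (hη : 0 < η)
    (hη4 : η ≤ 1 / 4) (h : ∀ x : ℕ, 3 ≤ x → ∀ z ∈ V (7 / 4) η, ‖H k f x z‖ ≤ M) :
    f ∈ locallyBoundedSystems (7 / 4) k := by
  refine mem_locallyBoundedSystems_of_uniform_bound hη
    (M := max M (Real.exp (3 * k) * ∑ n ∈ Finset.range 3, (2 : ℝ) ^ Ωf f n)) fun x z hz => ?_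
  by_cases hx : 3 ≤ x
  · exact (h x hx z hz).trans (le_max_left _ _)
  · push Not at hx
    have hz2 : ‖z‖ ≤ 2 := by have := norm_lt_of_mem_V hη4 hz; linarith
    exact (norm_H_le_of_le_two k f (by omega) hz2).trans (le_max_right _ _)

/-- **Composition (sorry-free): the seven stub STATEMENTS imply the crux statement** (body of the route decl,
via `normalFamilyBound_iff`). Bookkeeping: shrink `η := min (min η₁ (η₀/2)) (min η₂ (1/4))` so that the R+ phase
velocity bound (`η₁`), real-segment parity (`t < 2η ≤ η₀`) and the left-box upper bound (`η₂`) all apply on `V_η`;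
the two transfers bound `‖H_x‖` for `x ≥ 3` on `{Re z > 0}` and `{Re z ≤ 0}`; package. -/
theorem NormalFamilyBound_of_stubs
    (hA : ∀ (k : ℕ) (f : Fin k → ℤ[X]), IsBatemanHornSystem f → ∃ C : ℝ, ∀ x : ℕ, 3 ≤ x →
      ∀ r : ℝ, 0 < r → r ≤ 15 / 8 →
        ∑ n ∈ Finset.range (x + 1), r ^ Ωf f n ≤ C * x * Real.log x ^ ((k : ℝ) * (r - 1)))
    (hLB : ∀ (k : ℕ) (f : Fin k → ℤ[X]), IsBatemanHornSystem f → ∃ η : ℝ, 0 < η ∧ ∃ C K : ℝ, 0 ≤ K ∧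
      ∀ x : ℕ, 3 ≤ x → ∀ r θ : ℝ, 0 < r → r ≤ 15 / 8 → |θ| < Real.pi / 2 → |r * Real.sin θ| < η →
        Real.exp (-K) * Real.log x ^ (-((k : ℝ) * r * (1 - Real.cos θ))) *
            (∑ n ∈ Finset.range (x + 1), r ^ Ωf f n) ≤
          ‖∑ n ∈ Finset.range (x + 1), ((r : ℂ) * Complex.exp ((θ : ℂ) * Complex.I)) ^ Ωf f n‖ →
        (k : ℝ) * r * |Real.sin θ| * Real.log (Real.log x) - C ≤
          Real.sign θ *
            ((∑ n ∈ Finset.range (x + 1), (Ωf f n : ℂ) * ((r : ℂ) * Complex.exp ((θ : ℂ) * Complex.I)) ^ Ωf f n) /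
              (∑ n ∈ Finset.range (x + 1), ((r : ℂ) * Complex.exp ((θ : ℂ) * Complex.I)) ^ Ωf f n)).im)
    (hArc : ∀ (P : Polynomial ℂ) (r φ₀ φ₁ : ℝ) (b b' : ℝ → ℝ), 0 < r → φ₀ ≤ φ₁ →
      (∀ φ ∈ Set.Icc φ₀ φ₁, HasDerivAt b (b' φ) φ) →
      ‖P.eval ((r : ℂ) * Complex.exp ((φ₀ : ℂ) * Complex.I))‖ ≤ Real.exp (b φ₀) →
      (∀ φ ∈ Set.Ioo φ₀ φ₁,
        Real.exp (b φ) < ‖P.eval ((r : ℂ) * Complex.exp ((φ : ℂ) * Complex.I))‖ →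
          -(((r : ℂ) * Complex.exp ((φ : ℂ) * Complex.I) *
              (Polynomial.derivative P).eval ((r : ℂ) * Complex.exp ((φ : ℂ) * Complex.I)) /
              P.eval ((r : ℂ) * Complex.exp ((φ : ℂ) * Complex.I))).im) ≤ b' φ) →
      ∀ φ ∈ Set.Icc φ₀ φ₁, ‖P.eval ((r : ℂ) * Complex.exp ((φ : ℂ) * Complex.I))‖ ≤ Real.exp (b φ))
    (hBT : (∀ (P : Polynomial ℂ) (r φ₀ φ₁ : ℝ) (b b' : ℝ → ℝ), 0 < r → φ₀ ≤ φ₁ →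
      (∀ φ ∈ Set.Icc φ₀ φ₁, HasDerivAt b (b' φ) φ) →
      ‖P.eval ((r : ℂ) * Complex.exp ((φ₀ : ℂ) * Complex.I))‖ ≤ Real.exp (b φ₀) →
      (∀ φ ∈ Set.Ioo φ₀ φ₁,
        Real.exp (b φ) < ‖P.eval ((r : ℂ) * Complex.exp ((φ : ℂ) * Complex.I))‖ →
          -(((r : ℂ) * Complex.exp ((φ : ℂ) * Complex.I) *
              (Polynomial.derivative P).eval ((r : ℂ) * Complex.exp ((φ : ℂ) * Complex.I)) /
              P.eval ((r : ℂ) * Complex.exp ((φ : ℂ) * Complex.I))).im) ≤ b' φ) →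
      ∀ φ ∈ Set.Icc φ₀ φ₁, ‖P.eval ((r : ℂ) * Complex.exp ((φ : ℂ) * Complex.I))‖ ≤ Real.exp (b φ)) →
    ∀ (k : ℕ) (f : Fin k → ℤ[X]) (η C K Cr : ℝ), 0 < η → η ≤ 1 / 4 → 0 ≤ K →
      (∀ x : ℕ, 3 ≤ x → ∀ r θ : ℝ, 0 < r → r ≤ 15 / 8 → |θ| < Real.pi / 2 → |r * Real.sin θ| < η →
        Real.exp (-K) * Real.log x ^ (-((k : ℝ) * r * (1 - Real.cos θ))) *
            (∑ n ∈ Finset.range (x + 1), r ^ Ωf f n) ≤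
          ‖∑ n ∈ Finset.range (x + 1), ((r : ℂ) * Complex.exp ((θ : ℂ) * Complex.I)) ^ Ωf f n‖ →
        (k : ℝ) * r * |Real.sin θ| * Real.log (Real.log x) - C ≤
          Real.sign θ *
            ((∑ n ∈ Finset.range (x + 1), (Ωf f n : ℂ) * ((r : ℂ) * Complex.exp ((θ : ℂ) * Complex.I)) ^ Ωf f n) /
              (∑ n ∈ Finset.range (x + 1), ((r : ℂ) * Complex.exp ((θ : ℂ) * Complex.I)) ^ Ωf f n)).im) →
      (∀ x : ℕ, 3 ≤ x → ∀ r : ℝ, 0 < r → r ≤ 15 / 8 →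
        ∑ n ∈ Finset.range (x + 1), r ^ Ωf f n ≤ Cr * x * Real.log x ^ ((k : ℝ) * (r - 1))) →
      ∃ M : ℝ, ∀ x : ℕ, 3 ≤ x → ∀ z : ℂ, 0 < z.re → z.re < 7 / 4 → |z.im| < η → ‖H k f x z‖ ≤ M)
    (hP : ∀ (k : ℕ) (f : Fin k → ℤ[X]), IsBatemanHornSystem f → ∃ η₀ : ℝ, 0 < η₀ ∧ ∃ C₀ : ℝ,
      ∀ x : ℕ, 3 ≤ x → ∀ t : ℝ, 0 < t → t < η₀ →
        ‖∑ n ∈ Finset.range (x + 1), (-(t : ℂ)) ^ Ωf f n‖ ≤ C₀ * x * Real.log x ^ (-((k : ℝ) * (1 + t))))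
    (hUB : ∀ (k : ℕ) (f : Fin k → ℤ[X]), IsBatemanHornSystem f → ∃ η : ℝ, 0 < η ∧ ∃ C K : ℝ, 0 ≤ K ∧
      ∀ x : ℕ, 3 ≤ x → ∀ t φ : ℝ, 0 < t → t < 2 * η → Real.pi / 2 ≤ |φ| → |φ| ≤ Real.pi →
        |t * Real.sin φ| < η →
        Real.exp (-K) * x * Real.log x ^ ((k : ℝ) * (t * Real.cos φ - 1)) ≤
          ‖∑ n ∈ Finset.range (x + 1), ((t : ℂ) * Complex.exp ((φ : ℂ) * Complex.I)) ^ Ωf f n‖ →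
        Real.sign φ *
            ((∑ n ∈ Finset.range (x + 1), (Ωf f n : ℂ) * ((t : ℂ) * Complex.exp ((φ : ℂ) * Complex.I)) ^ Ωf f n) /
              (∑ n ∈ Finset.range (x + 1), ((t : ℂ) * Complex.exp ((φ : ℂ) * Complex.I)) ^ Ωf f n)).im ≤
          (k : ℝ) * t * |Real.sin φ| * Real.log (Real.log x) + C)
    (hNAT : (∀ (P : Polynomial ℂ) (r φ₀ φ₁ : ℝ) (b b' : ℝ → ℝ), 0 < r → φ₀ ≤ φ₁ →
      (∀ φ ∈ Set.Icc φ₀ φ₁, HasDerivAt b (b' φ) φ) →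
      ‖P.eval ((r : ℂ) * Complex.exp ((φ₀ : ℂ) * Complex.I))‖ ≤ Real.exp (b φ₀) →
      (∀ φ ∈ Set.Ioo φ₀ φ₁,
        Real.exp (b φ) < ‖P.eval ((r : ℂ) * Complex.exp ((φ : ℂ) * Complex.I))‖ →
          -(((r : ℂ) * Complex.exp ((φ : ℂ) * Complex.I) *
              (Polynomial.derivative P).eval ((r : ℂ) * Complex.exp ((φ : ℂ) * Complex.I)) /
              P.eval ((r : ℂ) * Complex.exp ((φ : ℂ) * Complex.I))).im) ≤ b' φ) →
      ∀ φ ∈ Set.Icc φ₀ φ₁, ‖P.eval ((r : ℂ) * Complex.exp ((φ : ℂ) * Complex.I))‖ ≤ Real.exp (b φ)) →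
    ∀ (k : ℕ) (f : Fin k → ℤ[X]) (η C₀ C K : ℝ), 0 < η → η ≤ 1 / 4 → 0 ≤ K →
      (∀ x : ℕ, 3 ≤ x → ∀ t : ℝ, 0 < t → t < 2 * η →
        ‖∑ n ∈ Finset.range (x + 1), (-(t : ℂ)) ^ Ωf f n‖ ≤ C₀ * x * Real.log x ^ (-((k : ℝ) * (1 + t)))) →
      (∀ x : ℕ, 3 ≤ x → ∀ t φ : ℝ, 0 < t → t < 2 * η → Real.pi / 2 ≤ |φ| → |φ| ≤ Real.pi →
        |t * Real.sin φ| < η →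
        Real.exp (-K) * x * Real.log x ^ ((k : ℝ) * (t * Real.cos φ - 1)) ≤
          ‖∑ n ∈ Finset.range (x + 1), ((t : ℂ) * Complex.exp ((φ : ℂ) * Complex.I)) ^ Ωf f n‖ →
        Real.sign φ *
            ((∑ n ∈ Finset.range (x + 1), (Ωf f n : ℂ) * ((t : ℂ) * Complex.exp ((φ : ℂ) * Complex.I)) ^ Ωf f n) /
              (∑ n ∈ Finset.range (x + 1), ((t : ℂ) * Complex.exp ((φ : ℂ) * Complex.I)) ^ Ωf f n)).im ≤
          (k : ℝ) * t * |Real.sin φ| * Real.log (Real.log x) + C) →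
      ∃ M : ℝ, ∀ x : ℕ, 3 ≤ x → ∀ z : ℂ, -η < z.re → z.re ≤ 0 → |z.im| < η → ‖H k f x z‖ ≤ M) :
    ∀ (k : ℕ) (f : Fin k → ℤ[X]), IsBatemanHornSystem f → f ∈ locallyBoundedSystems (7 / 4) k := by
  intro k f hf
  obtain ⟨Cr, hCr⟩ := hA k f hf
  obtain ⟨η₁, hη₁, C₁, K₁, hK₁, h₁⟩ := hLB k f hf
  obtain ⟨η₀, hη₀, C₀, h₀⟩ := hP k f hf
  obtain ⟨η₂, hη₂, C₂, K₂, hK₂, h₂⟩ := hUB k f hf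
  set η : ℝ := min (min η₁ (η₀ / 2)) (min η₂ (1 / 4)) with hηdef
  have hη : 0 < η := lt_min (lt_min hη₁ (by linarith)) (lt_min hη₂ (by norm_num))
  have hη4 : η ≤ 1 / 4 := (min_le_right _ _).trans (min_le_right _ _)
  have hηη₁ : η ≤ η₁ := (min_le_left _ _).trans (min_le_left _ _)
  have hηη₀ : 2 * η ≤ η₀ := by
    have : η ≤ η₀ / 2 := (min_le_left _ _).trans (min_le_right _ _)
    linarith
  have hηη₂ : η ≤ η₂ := (min_le_right _ _).trans (min_le_left _ _)
  -- R+ : bootstrap transfer at η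
  obtain ⟨M₁, hM₁⟩ := hBT hArc k f η C₁ K₁ Cr hη hη4 hK₁
    (fun x hx r θ hr hr' hθ hrs => h₁ x hx r θ hr hr' hθ (lt_of_lt_of_le hrs hηη₁)) hCr
  -- left box : negative-anchor transfer at η
  obtain ⟨M₂, hM₂⟩ := hNAT hArc k f η C₀ C₂ K₂ hη hη4 hK₂
    (fun x hx t ht ht' => h₀ x hx t ht (lt_of_lt_of_le ht' hηη₀))
    (fun x hx t φ ht ht' hφ hφ' hts => h₂ x hx t φ ht (lt_of_lt_of_le ht' (by linarith)) hφ hφ'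
      (lt_of_lt_of_le hts hηη₂))
  -- combine and package
  refine mem_locallyBoundedSystems_of_uniform_three_le hη hη4 (M := max M₁ M₂) fun x hx z hz => ?_
  obtain ⟨hz1, hz2, hz3⟩ := hz
  by_cases hre : 0 < z.re
  · exact (hM₁ x hx z hre hz2 hz3).trans (le_max_left _ _)
  · push Not at hre
    exact (hM₂ x hx z hz1 hre hz3).trans (le_max_right _ _)

/-- **The crux `NormalFamilyBound` (route SelbergDelangeRigidity, rank 2; item stmt-Parity-9769) — the route decl BY NAME,
from the seven stubs of line `Sketch` (renewal-phase-bootstrap).** -/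
theorem NormalFamilyBound_of : NormalFamilyBound :=
  normalFamilyBound_iff.mpr
    (NormalFamilyBound_of_stubs stub_realAxisOrder stub_phaseVelocityLB stub_arcBarrier stub_bootstrapTransfer
      stub_realSegmentParity stub_phaseVelocityUB stub_negativeAnchorTransfer)

end

end Summit.Parity.BatemanHorn.Cruxes.NormalFamilyBound.RenewalPhaseBootstrap
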